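import Literature.Probability.Process.StableLikeJumpChainExit
import Literature.Probability.Process.StableLikeJumpChainLattice
import HarnessLib

/-!
# Truncation of stable-like kernels and the off-diagonal upper bound

Support file for the proof of Bass–Levin 2002, Theorem 1.1
(`Literature.Probability.Process.bassLevin_thm_1_1`). For a Markov kernel `P` on `ℤ^d`,
reversible with respect to weights `m ≤ μ ≤ M`, with `P x y ≤ c₂ ‖x−y‖^{-(d+α)}`, we split
`P = K₁ + K₂` into the jumps of length `≤ ρ` and `> ρ` (Meyer's construction, Bass–Levin §2, §4)
and prove, for the powers `Q` of `P` and `R` of `K₁` (carried as recursion hypotheses, no new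
definitions):

* `kpow_le_trunc_kpow_add` : `Q n x y ≤ R n x y + n · c₂ ρ^{-(d+α)} · M/m` — a long jump lands with
  density at most `c₂ ρ^{-(d+α)}` and column sums of `Q` are at most `M/m`;
* `trunc_kpow_mass_ge` : the truncated chain loses mass at rate at most `c₂ C ρ^{-α}` per step;
* `exit_ball_le_of_tight` : under a tightness bound with a rate,
  `∑_{‖z−x‖>r} Q k x z ≤ U k^{β/α} r^{-β}` (`k ≥ 1`), the probability that the chain leaves the ball
  `B(z, ρ)` within `n` steps is at most `4 U n^{β/α} (ρ/2)^{-β}` (maximal inequality);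
* `trunc_exit_iter` : for the truncated chain the exit mass from `B(v, 2Iρ)` is at most `φ^I`
  (annulus crossing, iterated);
* `kpow_offdiag_bound` : the **off-diagonal upper bound**
  `Q n x y ≤ C n ‖x−y‖^{-(d+α)}` for `‖x − y‖ ≥ n^{1/α}`, from the on-diagonal bound
  `Q n x y ≤ C_D n^{-d/α}` and the tightness bound. With `kpow_diag_bound` this is Bass–Levin
  Thm 4.9; the route here (truncate at `ρ ≍ ‖x−y‖`, midpoint splitting for the truncated chain,
  Poisson-type escape bound by iterated annulus crossings) replaces the perturbation series of
  Bass–Levin Lemma 4.5 / Props. 4.6–4.8 and the parabolic Harnack inequality (Thm 3.1) used there.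

[folklore] (Meyer's construction; Bass–Levin 2002 §4.)

## References
* R. F. Bass, D. A. Levin, *Transition probabilities for symmetric jump processes*,
  Trans. Amer. Math. Soc. 354 (2002) 2933–2953, §2 (Prop. 2.6), §4 (Thm 4.9).
-/

noncomputable section

namespace Literature.Probability.Process

open scoped BigOperators

section Powers

variable {S : Type*}

/-- Every kernel has a (unique) sequence of powers satisfying the right Chapman–Kolmogorov
recursion used throughout (`Q 0 = 𝟙`, `Q (n+1) x y = ∑' z, Q n x z * K z y`). [folklore] -/
theorem exists_kpow [DecidableEq S] (K : S → S → ℝ) :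
    ∃ R : ℕ → S → S → ℝ, (∀ x y, R 0 x y = if x = y then 1 else 0) ∧
      (∀ n x y, R (n + 1) x y = ∑' z, R n x z * K z y) :=
  ⟨fun n => Nat.rec (fun x y => if x = y then (1 : ℝ) else 0)
    (fun _ Rn x y => ∑' z, Rn x z * K z y) n, fun _ _ => rfl, fun _ _ _ => rfl⟩

variable [DecidableEq S] {K : S → S → ℝ} {R : ℕ → S → S → ℝ}

/-- Row sums of the powers: `∑' z, R (k+1) x z = ∑' w, R k x w * ∑' z, K w z`. [folklore] -/
theorem kpow_tsum_succ (hK : ∀ x y, 0 ≤ K x y) (hKs : ∀ x, Summable (K x))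
    (hK1 : ∀ x, ∑' y, K x y ≤ 1)
    (hR0 : ∀ x y, R 0 x y = if x = y then 1 else 0)
    (hR : ∀ n x y, R (n + 1) x y = ∑' z, R n x z * K z y) (k : ℕ) (x : S) :
    ∑' z, R (k + 1) x z = ∑' w, R k x w * ∑' z, K w z := by
  have hRnn : ∀ k x w, 0 ≤ R k x w := kpow_nonneg hK hR0 hR
  have hnn : ∀ w z, 0 ≤ R k x w * K w z := fun w z => mul_nonneg (hRnn k x w) (hK w z)
  have h1 : ∀ w, Summable fun z => R k x w * K w z := fun w => (hKs w).mul_left _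
  have h2 : Summable fun w => ∑' z, R k x w * K w z := by
    refine (kpow_summable hK hKs hK1 hR0 hR k x).of_nonneg_of_le
      (fun w => tsum_nonneg (hnn w)) (fun w => ?_)
    rw [tsum_mul_left]
    exact mul_le_of_le_one_right (hRnn k x w) (hK1 w)
  have hfun : R (k + 1) x = fun z => ∑' w, R k x w * K w z := by funext z; rw [hR]
  rw [hfun, tsum_swap_of_nonneg hnn h1 h2]
  exact tsum_congr fun w => tsum_mul_left

/-- **Mass loss of a sub-Markov chain**: if every row of `K` has mass at least `1 - ε` (`ε ≥ 0`),
then after `k` steps the surviving mass is at least `1 - k ε`. [folklore] -/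
theorem kpow_tsum_ge (hK : ∀ x y, 0 ≤ K x y) (hKs : ∀ x, Summable (K x))
    (hK1 : ∀ x, ∑' y, K x y ≤ 1)
    (hR0 : ∀ x y, R 0 x y = if x = y then 1 else 0)
    (hR : ∀ n x y, R (n + 1) x y = ∑' z, R n x z * K z y) {ε : ℝ} (hε : 0 ≤ ε)
    (hKε : ∀ x, 1 - ε ≤ ∑' y, K x y) (k : ℕ) (x : S) :
    1 - k * ε ≤ ∑' z, R k x z := by
  have hRnn : ∀ k x w, 0 ≤ R k x w := kpow_nonneg hK hR0 hR
  induction k with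
  | zero =>
    have h0 : R 0 x = fun y => if y = x then (1 : ℝ) else 0 := by
      funext y; rw [hR0]; by_cases h : x = y <;> simp [h, eq_comm]
    rw [h0, tsum_ite_eq]; simp
  | succ k ih =>
    rw [kpow_tsum_succ hK hKs hK1 hR0 hR k x]
    have hmass1 : ∑' w, R k x w ≤ 1 := kpow_tsum_le_one hK hKs hK1 hR0 hR k x
    have hs : Summable (R k x) := kpow_summable hK hKs hK1 hR0 hR k x
    have hle : ∑' w, R k x w * (1 - ε) ≤ ∑' w, R k x w * ∑' z, K w z :=
      Summable.tsum_le_tsum (fun w => mul_le_mul_of_nonneg_left (hKε w) (hRnn k x w))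
        (hs.mul_right _)
        (hs.of_nonneg_of_le (fun w => mul_nonneg (hRnn k x w) (tsum_nonneg (hK w)))
          (fun w => mul_le_of_le_one_right (hRnn k x w) (hK1 w)))
    rw [tsum_mul_right] at hle
    have h0 : 0 ≤ ∑' w, R k x w := tsum_nonneg (fun w => hRnn k x w)
    push_cast
    nlinarith

end Powers

section LatticeTail

variable {d : ℕ}

/-- **Tail of the lattice power sum, real radius.** For `d ≥ 1`, `α > 0` and every real `ρ > 0`,
the family `h ↦ ‖h‖^{-(d+α)} 𝟙{‖h‖ > ρ}` on `ℤ^d` is summable with sum at most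
`2^α (3^d + 2d 3^{d-1}/α) ρ^{-α}`. [folklore] -/
theorem tsum_norm_rpow_neg_far_le (hd : 1 ≤ d) {α : ℝ} (hα : 0 < α) {ρ : ℝ} (hρ : 0 < ρ) :
    (Summable fun h : Fin d → ℤ => if ρ < ‖h‖ then ‖h‖ ^ (-((d : ℝ) + α)) else 0) ∧
      ∑' h : Fin d → ℤ, (if ρ < ‖h‖ then ‖h‖ ^ (-((d : ℝ) + α)) else 0) ≤
        (2 : ℝ) ^ α * (3 ^ d + 2 * d * 3 ^ (d - 1) / α) * ρ ^ (-α) := by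
  set s : ℝ := (d : ℝ) + α with hs
  have hds : (d : ℝ) < s := by rw [hs]; linarith
  obtain ⟨hZs, hZle⟩ := summable_norm_rpow_neg hd hds
  have hsd : s - d = α := by rw [hs]; ring
  rw [hsd] at hZle
  set Z : ℝ := 3 ^ d + 2 * d * 3 ^ (d - 1) / α with hZ
  have hZnn : 0 ≤ Z := by rw [hZ]; positivity
  have hnn : ∀ h : Fin d → ℤ, 0 ≤ (if ρ < ‖h‖ then ‖h‖ ^ (-s) else 0) := by
    intro h; split_ifs
    · exact Real.rpow_nonneg (norm_nonneg _) _
    · exact le_rfl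
  have hdom : ∀ h : Fin d → ℤ, (if ρ < ‖h‖ then ‖h‖ ^ (-s) else 0) ≤
      (if h = 0 then (0 : ℝ) else ‖h‖ ^ (-s)) := by
    intro h
    by_cases hρh : ρ < ‖h‖
    · have hne : h ≠ 0 := by
        intro h0; rw [h0, norm_zero] at hρh; linarith
      rw [if_pos hρh, if_neg hne]
    · rw [if_neg hρh]; split_ifs
      · exact le_rfl
      · exact Real.rpow_nonneg (norm_nonneg _) _
  have hsum : Summable fun h : Fin d → ℤ => if ρ < ‖h‖ then ‖h‖ ^ (-s) else 0 :=
    hZs.of_nonneg_of_le hnn hdom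
  refine ⟨hsum, ?_⟩
  have h2α : (1 : ℝ) ≤ (2 : ℝ) ^ α := Real.one_le_rpow (by norm_num) hα.le
  have hρα : 0 < ρ ^ (-α) := Real.rpow_pos_of_pos hρ _
  by_cases hρ1 : ρ < 1
  · -- small radius: bound by the whole sum, and ρ^{-α} ≥ 1
    have h1 : (1 : ℝ) ≤ ρ ^ (-α) := by
      rw [Real.rpow_neg hρ.le]
      exact one_le_inv_iff₀.mpr ⟨Real.rpow_pos_of_pos hρ _,
        Real.rpow_le_one hρ.le hρ1.le hα.le⟩
    calc ∑' h : Fin d → ℤ, (if ρ < ‖h‖ then ‖h‖ ^ (-s) else 0)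
        ≤ ∑' h : Fin d → ℤ, (if h = 0 then (0 : ℝ) else ‖h‖ ^ (-s)) :=
          Summable.tsum_le_tsum hdom hsum hZs
      _ ≤ Z := hZle
      _ = 1 * Z * 1 := by ring
      _ ≤ (2 : ℝ) ^ α * Z * ρ ^ (-α) := by gcongr
  · -- large radius: tail bound beyond the integer ⌊ρ⌋ ≥ 1
    push Not at hρ1
    set r : ℕ := ⌊ρ⌋₊ with hr
    have hr1 : 1 ≤ r := by rw [hr]; exact Nat.le_floor (by exact_mod_cast hρ1)
    have hrρ : (r : ℝ) ≤ ρ := Nat.floor_le hρ.le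
    have hr0 : (0 : ℝ) < r := by exact_mod_cast hr1
    have hρr : ρ / 2 ≤ r := by
      have := Nat.lt_floor_add_one ρ
      rw [← hr] at this
      by_cases h2 : (2 : ℝ) ≤ ρ
      · linarith
      · push Not at h2
        have : (1 : ℝ) ≤ r := by exact_mod_cast hr1
        linarith
    have hbound : ∀ u : Finset (Fin d → ℤ), ∑ h ∈ u, (if ρ < ‖h‖ then ‖h‖ ^ (-s) else 0) ≤
        (2 : ℝ) ^ α * Z * ρ ^ (-α) := by
      intro u
      classical
      rw [← Finset.sum_filter]
      have hB := sum_norm_rpow_le_of_norm_gt hd hds hr1 (u.filter fun h => ρ < ‖h‖)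
        (fun h hh => lt_of_le_of_lt hrρ (Finset.mem_filter.mp hh).2)
      rw [hsd, show (d : ℝ) - s = -α by rw [hs]; ring] at hB
      have hrα : (r : ℝ) ^ (-α) ≤ (2 : ℝ) ^ α * ρ ^ (-α) := by
        calc (r : ℝ) ^ (-α) ≤ (ρ / 2) ^ (-α) :=
              Real.rpow_le_rpow_of_nonpos (by positivity) hρr (by linarith)
          _ = (2 : ℝ) ^ α * ρ ^ (-α) := by
              rw [Real.div_rpow hρ.le (by norm_num), Real.rpow_neg (by norm_num : (0:ℝ) ≤ 2),
                div_inv_eq_mul, mul_comm]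
      calc ∑ h ∈ u.filter (fun h => ρ < ‖h‖), ‖h‖ ^ (-s)
          ≤ 2 * d * 3 ^ (d - 1) / α * (r : ℝ) ^ (-α) := hB
        _ ≤ Z * (r : ℝ) ^ (-α) := by
            refine mul_le_mul_of_nonneg_right ?_ (Real.rpow_nonneg hr0.le _)
            rw [hZ]
            have : (0 : ℝ) ≤ 3 ^ d := by positivity
            linarith
        _ ≤ Z * ((2 : ℝ) ^ α * ρ ^ (-α)) := mul_le_mul_of_nonneg_left hrα hZnn
        _ = (2 : ℝ) ^ α * Z * ρ ^ (-α) := by ring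
    exact Real.tsum_le_of_sum_le hnn hbound

end LatticeTail

section Trunc

variable {d : ℕ} {P K₁ K₂ : (Fin d → ℤ) → (Fin d → ℤ) → ℝ}
  {Q R : ℕ → (Fin d → ℤ) → (Fin d → ℤ) → ℝ} {μ : (Fin d → ℤ) → ℝ} {m M c₂ α ρ : ℝ}

/-! ### The truncated kernel `K₁` (jumps of length `≤ ρ`) and the long-jump kernel `K₂` -/

/-- The truncated kernel is nonnegative. [folklore] -/
theorem trunc_nonneg (hP0 : ∀ x y, 0 ≤ P x y)
    (hK₁ : ∀ w z, K₁ w z = if ‖w - z‖ ≤ ρ then P w z else 0) (w z : Fin d → ℤ) :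
    0 ≤ K₁ w z := by
  rw [hK₁]; split_ifs
  · exact hP0 w z
  · exact le_rfl

/-- The truncated kernel is dominated by the kernel. [folklore] -/
theorem trunc_le (hP0 : ∀ x y, 0 ≤ P x y)
    (hK₁ : ∀ w z, K₁ w z = if ‖w - z‖ ≤ ρ then P w z else 0) (w z : Fin d → ℤ) :
    K₁ w z ≤ P w z := by
  rw [hK₁]; split_ifs
  · exact le_rfl
  · exact hP0 w z

/-- The long-jump kernel is nonnegative. [folklore] -/
theorem bigJump_nonneg (hP0 : ∀ x y, 0 ≤ P x y)
    (hK₂ : ∀ w z, K₂ w z = if ‖w - z‖ ≤ ρ then 0 else P w z) (w z : Fin d → ℤ) :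
    0 ≤ K₂ w z := by
  rw [hK₂]; split_ifs
  · exact le_rfl
  · exact hP0 w z

/-- The long-jump kernel is dominated by the kernel. [folklore] -/
theorem bigJump_le (hP0 : ∀ x y, 0 ≤ P x y)
    (hK₂ : ∀ w z, K₂ w z = if ‖w - z‖ ≤ ρ then 0 else P w z) (w z : Fin d → ℤ) :
    K₂ w z ≤ P w z := by
  rw [hK₂]; split_ifs
  · exact hP0 w z
  · exact le_rfl

/-- Meyer's splitting `P = K₁ + K₂`. [folklore] -/
theorem trunc_add_bigJump (hK₁ : ∀ w z, K₁ w z = if ‖w - z‖ ≤ ρ then P w z else 0)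
    (hK₂ : ∀ w z, K₂ w z = if ‖w - z‖ ≤ ρ then 0 else P w z) (w z : Fin d → ℤ) :
    P w z = K₁ w z + K₂ w z := by
  rw [hK₁, hK₂]; split_ifs <;> simp

/-- Rows of the truncated kernel are summable. [folklore] -/
theorem trunc_summable (hP0 : ∀ x y, 0 ≤ P x y) (hPs : ∀ x, Summable (P x))
    (hK₁ : ∀ w z, K₁ w z = if ‖w - z‖ ≤ ρ then P w z else 0) (w : Fin d → ℤ) :
    Summable (K₁ w) :=
  (hPs w).of_nonneg_of_le (trunc_nonneg hP0 hK₁ w) (trunc_le hP0 hK₁ w)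

/-- Rows of the truncated kernel have mass at most `1`. [folklore] -/
theorem trunc_tsum_le_one (hP0 : ∀ x y, 0 ≤ P x y) (hPs : ∀ x, Summable (P x))
    (hP1' : ∀ x, ∑' y, P x y ≤ 1)
    (hK₁ : ∀ w z, K₁ w z = if ‖w - z‖ ≤ ρ then P w z else 0) (w : Fin d → ℤ) :
    ∑' z, K₁ w z ≤ 1 :=
  (Summable.tsum_le_tsum (trunc_le hP0 hK₁ w) (trunc_summable hP0 hPs hK₁ w) (hPs w)).trans
    (hP1' w)

/-- Rows of the long-jump kernel are summable. [folklore] -/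
theorem bigJump_summable (hP0 : ∀ x y, 0 ≤ P x y) (hPs : ∀ x, Summable (P x))
    (hK₂ : ∀ w z, K₂ w z = if ‖w - z‖ ≤ ρ then 0 else P w z) (w : Fin d → ℤ) :
    Summable (K₂ w) :=
  (hPs w).of_nonneg_of_le (bigJump_nonneg hP0 hK₂ w) (bigJump_le hP0 hK₂ w)

/-- The truncated kernel of a reversible kernel is reversible (the truncation is symmetric).
[folklore] -/
theorem trunc_reversible (hrev : ∀ x y, μ x * P x y = μ y * P y x)
    (hK₁ : ∀ w z, K₁ w z = if ‖w - z‖ ≤ ρ then P w z else 0) (w z : Fin d → ℤ) :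
    μ w * K₁ w z = μ z * K₁ z w := by
  rw [hK₁, hK₁, norm_sub_rev z w]
  split_ifs <;> simp [hrev w z]

/-- **Landing density of long jumps**: `K₂ w z ≤ c₂ ρ^{-(d+α)}`. [folklore] -/
theorem bigJump_le_rpow (hub : ∀ x y, P x y ≤ c₂ * ‖x - y‖ ^ (-((d : ℝ) + α))) (hc₂ : 0 ≤ c₂)
    (hαd : 0 ≤ (d : ℝ) + α) (hρ : 0 < ρ)
    (hK₂ : ∀ w z, K₂ w z = if ‖w - z‖ ≤ ρ then 0 else P w z) (w z : Fin d → ℤ) :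
    K₂ w z ≤ c₂ * ρ ^ (-((d : ℝ) + α)) := by
  rw [hK₂]; split_ifs with h
  · exact mul_nonneg hc₂ (Real.rpow_nonneg hρ.le _)
  · push Not at h
    calc P w z ≤ c₂ * ‖w - z‖ ^ (-((d : ℝ) + α)) := hub w z
      _ ≤ c₂ * ρ ^ (-((d : ℝ) + α)) :=
          mul_le_mul_of_nonneg_left (Real.rpow_le_rpow_of_nonpos hρ h.le (by linarith)) hc₂

/-- **Total rate of long jumps**: `∑_z K₂ w z ≤ c₂ · 2^α (3^d + 2d3^{d-1}/α) · ρ^{-α}`. [folklore] -/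
theorem bigJump_tsum_le (hd : 1 ≤ d) (hα : 0 < α) (hP0 : ∀ x y, 0 ≤ P x y)
    (hPs : ∀ x, Summable (P x))
    (hub : ∀ x y, P x y ≤ c₂ * ‖x - y‖ ^ (-((d : ℝ) + α))) (hc₂ : 0 ≤ c₂) (hρ : 0 < ρ)
    (hK₂ : ∀ w z, K₂ w z = if ‖w - z‖ ≤ ρ then 0 else P w z) (w : Fin d → ℤ) :
    ∑' z, K₂ w z ≤ c₂ * ((2 : ℝ) ^ α * (3 ^ d + 2 * d * 3 ^ (d - 1) / α)) * ρ ^ (-α) := by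
  obtain ⟨hfs, hfle⟩ := tsum_norm_rpow_neg_far_le hd hα hρ
  set s : ℝ := (d : ℝ) + α with hs
  have hpt : ∀ z, K₂ w z ≤ c₂ * (if ρ < ‖z - w‖ then ‖z - w‖ ^ (-s) else 0) := by
    intro z
    rw [hK₂]
    by_cases h : ‖w - z‖ ≤ ρ
    · rw [if_pos h]
      refine mul_nonneg hc₂ ?_
      split_ifs
      · exact Real.rpow_nonneg (norm_nonneg _) _
      · exact le_rfl
    · rw [if_neg h, norm_sub_rev z w, if_pos (lt_of_not_ge h)]
      exact hub w z
  have hmaj : Summable fun z => c₂ * (if ρ < ‖z - w‖ then ‖z - w‖ ^ (-s) else 0) :=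
    ((Equiv.subRight w).summable_iff.mpr hfs).mul_left c₂
  calc ∑' z, K₂ w z ≤ ∑' z, c₂ * (if ρ < ‖z - w‖ then ‖z - w‖ ^ (-s) else 0) :=
        Summable.tsum_le_tsum hpt (bigJump_summable hP0 hPs hK₂ w) hmaj
    _ = c₂ * ∑' z, (if ρ < ‖z - w‖ then ‖z - w‖ ^ (-s) else 0) := tsum_mul_left
    _ = c₂ * ∑' h : Fin d → ℤ, (if ρ < ‖h‖ then ‖h‖ ^ (-s) else 0) := by
        congr 1
        exact (Equiv.subRight w).tsum_eq (fun h => if ρ < ‖h‖ then ‖h‖ ^ (-s) else 0)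
    _ ≤ c₂ * ((2 : ℝ) ^ α * (3 ^ d + 2 * d * 3 ^ (d - 1) / α) * ρ ^ (-α)) :=
        mul_le_mul_of_nonneg_left hfle hc₂
    _ = c₂ * ((2 : ℝ) ^ α * (3 ^ d + 2 * d * 3 ^ (d - 1) / α)) * ρ ^ (-α) := by ring

/-- Rows of the truncated kernel have mass at least `1 - c₂ 2^α(3^d + 2d3^{d-1}/α) ρ^{-α}`.
[folklore] -/
theorem trunc_tsum_ge (hd : 1 ≤ d) (hα : 0 < α) (hP0 : ∀ x y, 0 ≤ P x y)
    (hP1 : ∀ x, HasSum (P x) 1)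
    (hub : ∀ x y, P x y ≤ c₂ * ‖x - y‖ ^ (-((d : ℝ) + α))) (hc₂ : 0 ≤ c₂) (hρ : 0 < ρ)
    (hK₁ : ∀ w z, K₁ w z = if ‖w - z‖ ≤ ρ then P w z else 0)
    (hK₂ : ∀ w z, K₂ w z = if ‖w - z‖ ≤ ρ then 0 else P w z) (w : Fin d → ℤ) :
    1 - c₂ * ((2 : ℝ) ^ α * (3 ^ d + 2 * d * 3 ^ (d - 1) / α)) * ρ ^ (-α) ≤ ∑' z, K₁ w z := by
  have hPs : ∀ x, Summable (P x) := fun x => (hP1 x).summable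
  have hsplit : ∑' z, K₁ w z + ∑' z, K₂ w z = 1 := by
    rw [← Summable.tsum_add (trunc_summable hP0 hPs hK₁ w) (bigJump_summable hP0 hPs hK₂ w)]
    have : (fun z => K₁ w z + K₂ w z) = P w := funext fun z => (trunc_add_bigJump hK₁ hK₂ w z).symm
    rw [this]
    exact (hP1 w).tsum_eq
  have := bigJump_tsum_le hd hα hP0 hPs hub hc₂ hρ hK₂ w
  linarith

/-! ### Powers of the truncated kernel -/

/-- **Meyer decomposition, upper bound**: `Q n x y ≤ R n x y + n · c₂ ρ^{-(d+α)} · M/m` for the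
powers `Q` of `P` and `R` of the truncated kernel: a long jump lands at any given point with
probability at most `c₂ ρ^{-(d+α)}`, and afterwards the column sums of `Q` are at most `M/m`.
Bass–Levin use the continuous-time perturbation series instead (Prop. 2.6, Prop. 4.6).
[cite: BassLevin2002, §4 proof of Prop. 4.6] -/
theorem kpow_le_trunc_kpow_add (hP0 : ∀ x y, 0 ≤ P x y) (hP1 : ∀ x, HasSum (P x) 1)
    (hμ : ∀ x, m ≤ μ x ∧ μ x ≤ M) (hm : 0 < m)
    (hrev : ∀ x y, μ x * P x y = μ y * P y x)
    (hub : ∀ x y, P x y ≤ c₂ * ‖x - y‖ ^ (-((d : ℝ) + α))) (hc₂ : 0 ≤ c₂)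
    (hαd : 0 ≤ (d : ℝ) + α) (hρ : 0 < ρ)
    (hK₁ : ∀ w z, K₁ w z = if ‖w - z‖ ≤ ρ then P w z else 0)
    (hK₂ : ∀ w z, K₂ w z = if ‖w - z‖ ≤ ρ then 0 else P w z)
    (hQ0 : ∀ x y, Q 0 x y = if x = y then 1 else 0)
    (hQ : ∀ n x y, Q (n + 1) x y = ∑' z, Q n x z * P z y)
    (hR0 : ∀ x y, R 0 x y = if x = y then 1 else 0)
    (hR : ∀ n x y, R (n + 1) x y = ∑' z, R n x z * K₁ z y) (n : ℕ) (x y : Fin d → ℤ) :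
    Q n x y ≤ R n x y + n * (c₂ * ρ ^ (-((d : ℝ) + α))) * (M / m) := by
  have hPs : ∀ x, Summable (P x) := fun x => (hP1 x).summable
  have hP1' : ∀ x, ∑' y, P x y ≤ 1 := fun x => ((hP1 x).tsum_eq).le
  have hμnn : ∀ x, 0 ≤ μ x := fun x => hm.le.trans (hμ x).1
  have hK₁nn : ∀ w z, 0 ≤ K₁ w z := trunc_nonneg hP0 hK₁
  have hK₂nn : ∀ w z, 0 ≤ K₂ w z := bigJump_nonneg hP0 hK₂
  have hK₁s : ∀ w, Summable (K₁ w) := trunc_summable hP0 hPs hK₁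
  have hK₁1 : ∀ w, ∑' z, K₁ w z ≤ 1 := trunc_tsum_le_one hP0 hPs hP1' hK₁
  have hQnn : ∀ k x w, 0 ≤ Q k x w := kpow_nonneg hP0 hQ0 hQ
  have hRnn : ∀ k x w, 0 ≤ R k x w := kpow_nonneg hK₁nn hR0 hR
  set s : ℝ := (d : ℝ) + α with hs
  have hmeyer := kpow_meyer (K := P) (Q := Q) (K₁ := K₁) (K₂ := K₂) (R := R) hK₁nn hK₂nn
    (trunc_add_bigJump hK₁ hK₂) hPs hP1' hQ0 hQ hR0 hR n x y
  -- column sums of Q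
  have hcol : ∀ j, (Summable fun z => Q j z y) ∧ ∑' z, Q j z y ≤ M / m := by
    intro j
    obtain ⟨hcs, hcle⟩ := kpow_column hP0 hPs hP1' hQ0 hQ hμnn hrev j y
    have hpt : ∀ z, Q j z y ≤ m⁻¹ * (μ z * Q j z y) := by
      intro z
      rw [← mul_assoc]
      refine le_mul_of_one_le_left (hQnn j z y) ?_
      rw [inv_mul_eq_div, one_le_div hm]; exact (hμ z).1
    have hs' : Summable fun z => Q j z y :=
      (hcs.mul_left m⁻¹).of_nonneg_of_le (fun z => hQnn j z y) hpt
    refine ⟨hs', ?_⟩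
    have hM : μ y ≤ M := (hμ y).2
    calc ∑' z, Q j z y ≤ ∑' z, m⁻¹ * (μ z * Q j z y) :=
          Summable.tsum_le_tsum hpt hs' (hcs.mul_left m⁻¹)
      _ = m⁻¹ * ∑' z, μ z * Q j z y := tsum_mul_left
      _ ≤ m⁻¹ * M := mul_le_mul_of_nonneg_left (hcle.trans hM) (inv_nonneg.mpr hm.le)
      _ = M / m := by rw [inv_mul_eq_div]
  -- the landing density of the first long jump
  have hν : ∀ k z, ∑' w, R k x w * K₂ w z ≤ c₂ * ρ ^ (-s) := by
    intro k z
    have hb : ∀ w, K₂ w z ≤ c₂ * ρ ^ (-s) := fun w => bigJump_le_rpow hub hc₂ hαd hρ hK₂ w z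
    have hsR : Summable (R k x) := kpow_summable hK₁nn hK₁s hK₁1 hR0 hR k x
    calc ∑' w, R k x w * K₂ w z ≤ ∑' w, R k x w * (c₂ * ρ ^ (-s)) :=
          Summable.tsum_le_tsum (fun w => mul_le_mul_of_nonneg_left (hb w) (hRnn k x w))
            ((hsR.mul_right _).of_nonneg_of_le (fun w => mul_nonneg (hRnn k x w) (hK₂nn w z))
              (fun w => mul_le_mul_of_nonneg_left (hb w) (hRnn k x w)))
            (hsR.mul_right _)
      _ = (∑' w, R k x w) * (c₂ * ρ ^ (-s)) := tsum_mul_right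
      _ ≤ 1 * (c₂ * ρ ^ (-s)) :=
          mul_le_mul_of_nonneg_right (kpow_tsum_le_one hK₁nn hK₁s hK₁1 hR0 hR k x)
            (mul_nonneg hc₂ (Real.rpow_nonneg hρ.le _))
      _ = c₂ * ρ ^ (-s) := one_mul _
  have hνnn : ∀ k z, 0 ≤ ∑' w, R k x w * K₂ w z :=
    fun k z => tsum_nonneg fun w => mul_nonneg (hRnn k x w) (hK₂nn w z)
  have hterm : ∀ k j, ∑' z, (∑' w, R k x w * K₂ w z) * Q j z y ≤ c₂ * ρ ^ (-s) * (M / m) := by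
    intro k j
    obtain ⟨hcs, hcle⟩ := hcol j
    have hpt : ∀ z, (∑' w, R k x w * K₂ w z) * Q j z y ≤ (c₂ * ρ ^ (-s)) * Q j z y :=
      fun z => mul_le_mul_of_nonneg_right (hν k z) (hQnn j z y)
    calc ∑' z, (∑' w, R k x w * K₂ w z) * Q j z y ≤ ∑' z, (c₂ * ρ ^ (-s)) * Q j z y :=
          Summable.tsum_le_tsum hpt
            ((hcs.mul_left _).of_nonneg_of_le (fun z => mul_nonneg (hνnn k z) (hQnn j z y)) hpt)
            (hcs.mul_left _)
      _ = (c₂ * ρ ^ (-s)) * ∑' z, Q j z y := tsum_mul_left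
      _ ≤ (c₂ * ρ ^ (-s)) * (M / m) :=
          mul_le_mul_of_nonneg_left hcle (mul_nonneg hc₂ (Real.rpow_nonneg hρ.le _))
  rw [hmeyer]
  calc R n x y + ∑ k ∈ Finset.range n, ∑' z, (∑' w, R k x w * K₂ w z) * Q (n - 1 - k) z y
      ≤ R n x y + ∑ k ∈ Finset.range n, c₂ * ρ ^ (-s) * (M / m) := by
        gcongr with k hk
        exact hterm k _
    _ = R n x y + n * (c₂ * ρ ^ (-s)) * (M / m) := by
        rw [Finset.sum_const, Finset.card_range, nsmul_eq_mul]; ring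

/-- **Survival of the truncated chain**: after `k` steps the mass of `R k x ·` is at least
`1 - k · c₂ 2^α(3^d + 2d3^{d-1}/α) ρ^{-α}`. [folklore] -/
theorem trunc_kpow_tsum_ge (hd : 1 ≤ d) (hα : 0 < α) (hP0 : ∀ x y, 0 ≤ P x y)
    (hP1 : ∀ x, HasSum (P x) 1)
    (hub : ∀ x y, P x y ≤ c₂ * ‖x - y‖ ^ (-((d : ℝ) + α))) (hc₂ : 0 ≤ c₂) (hρ : 0 < ρ)
    (hK₁ : ∀ w z, K₁ w z = if ‖w - z‖ ≤ ρ then P w z else 0)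
    (hR0 : ∀ x y, R 0 x y = if x = y then 1 else 0)
    (hR : ∀ n x y, R (n + 1) x y = ∑' z, R n x z * K₁ z y) (k : ℕ) (x : Fin d → ℤ) :
    1 - k * (c₂ * ((2 : ℝ) ^ α * (3 ^ d + 2 * d * 3 ^ (d - 1) / α)) * ρ ^ (-α)) ≤
      ∑' z, R k x z := by
  have hPs : ∀ x, Summable (P x) := fun x => (hP1 x).summable
  have hP1' : ∀ x, ∑' y, P x y ≤ 1 := fun x => ((hP1 x).tsum_eq).le
  set K₂ : (Fin d → ℤ) → (Fin d → ℤ) → ℝ := fun w z => if ‖w - z‖ ≤ ρ then 0 else P w z with hK₂def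
  have hK₂ : ∀ w z, K₂ w z = if ‖w - z‖ ≤ ρ then 0 else P w z := fun w z => rfl
  exact kpow_tsum_ge (trunc_nonneg hP0 hK₁) (trunc_summable hP0 hPs hK₁)
    (trunc_tsum_le_one hP0 hPs hP1' hK₁) hR0 hR (by positivity)
    (trunc_tsum_ge hd hα hP0 hP1 hub hc₂ hρ hK₁ hK₂) k x

/-! ### Exit from balls: the maximal inequality under a tightness bound -/

/-- **Exit probability from a ball under tightness with a rate.** If
`∑_{‖z−x‖>r} Q k x z ≤ U k^{β/α} r^{-β}` for all `k ≥ 1`, `r > 0`, then the mass of the chain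
started at `z` that leaves `B(z, ρ)` within `n ≥ 1` steps is at most `2 U n^{β/α} (ρ/2)^{-β}`
(maximal inequality `exit_mass_le_of_inner` with inner ball `B(z, ρ/2)`). Bass–Levin Thm 2.8 is
the qualitative form. [cite: BassLevin2002, Thm 2.8] -/
theorem exit_ball_le_of_tight (hP0 : ∀ x y, 0 ≤ P x y) (hP1 : ∀ x, HasSum (P x) 1)
    (hQ0 : ∀ x y, Q 0 x y = if x = y then 1 else 0)
    (hQ : ∀ n x y, Q (n + 1) x y = ∑' z, Q n x z * P z y)
    {β U : ℝ} (hβα : 0 ≤ β / α) (hU : 0 ≤ U)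
    (hT : ∀ (k : ℕ) (x : Fin d → ℤ) (r : ℝ), 1 ≤ k → 0 < r →
      ∑' z, {z | r < ‖z - x‖}.indicator (Q k x) z ≤ U * (k : ℝ) ^ (β / α) * r ^ (-β))
    (hρ : 0 < ρ) (z : Fin d → ℤ) {RP : ℕ → (Fin d → ℤ) → (Fin d → ℤ) → ℝ}
    (hRP0 : ∀ x y, RP 0 x y = if x = y then 1 else 0)
    (hRP : ∀ n x y, RP (n + 1) x y =
      ∑' w, RP n x w * (Metric.closedBall z ρ).indicator (P w) y)
    (n : ℕ) (hn : 1 ≤ n) :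
    ∑ j ∈ Finset.range n, ∑' u, ∑' w, RP j z w * (Metric.closedBall z ρ)ᶜ.indicator (P w) u ≤
      2 * (U * (n : ℝ) ^ (β / α) * (ρ / 2) ^ (-β)) := by
  have hPs : ∀ x, Summable (P x) := fun x => (hP1 x).summable
  have hP1' : ∀ x, ∑' y, P x y ≤ 1 := fun x => ((hP1 x).tsum_eq).le
  have hQnn : ∀ k x w, 0 ≤ Q k x w := kpow_nonneg hP0 hQ0 hQ
  set σ : ℝ := U * (n : ℝ) ^ (β / α) * (ρ / 2) ^ (-β) with hσ
  have hρ2 : 0 < ρ / 2 := by positivity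
  have hσnn : 0 ≤ σ := by
    rw [hσ]; exact mul_nonneg (mul_nonneg hU (Real.rpow_nonneg (Nat.cast_nonneg n) _))
      (Real.rpow_nonneg hρ2.le _)
  set A : Set (Fin d → ℤ) := Metric.closedBall z (ρ / 2) with hA
  -- far masses beyond ρ/2 at times 1 ≤ m' ≤ n are at most σ
  have hfarσ : ∀ (u : Fin d → ℤ) (m' : ℕ), 1 ≤ m' → m' ≤ n →
      ∑' y, {y | ρ / 2 < ‖y - u‖}.indicator (Q m' u) y ≤ σ := by
    intro u m' hm'1 hm'n
    calc ∑' y, {y | ρ / 2 < ‖y - u‖}.indicator (Q m' u) y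
        ≤ U * (m' : ℝ) ^ (β / α) * (ρ / 2) ^ (-β) := hT m' u (ρ / 2) hm'1 hρ2
      _ ≤ σ := by
          rw [hσ]
          refine mul_le_mul_of_nonneg_right (mul_le_mul_of_nonneg_left ?_ hU)
            (Real.rpow_nonneg hρ2.le _)
          exact Real.rpow_le_rpow (Nat.cast_nonneg m') (by exact_mod_cast hm'n) hβα
  have hσ' : ∀ u, u ∉ Metric.closedBall z ρ → ∀ m', m' ≤ n →
      ∑' y, A.indicator (Q m' u) y ≤ σ := by
    intro u hu m' hm'
    rw [Metric.mem_closedBall, dist_eq_norm, not_le] at hu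
    rcases Nat.eq_zero_or_pos m' with h0 | hm'pos
    · subst h0
      have : (fun y => A.indicator (Q 0 u) y) = fun _ => 0 := by
        funext y
        by_cases hy : y ∈ A
        · rw [Set.indicator_of_mem hy, hQ0]
          have : u ≠ y := by
            intro huy; subst huy
            rw [hA, Metric.mem_closedBall, dist_eq_norm] at hy
            linarith
          simp [this]
        · rw [Set.indicator_of_notMem hy]
      rw [this, tsum_zero]; exact hσnn
    · have hpt : ∀ y, A.indicator (Q m' u) y ≤ {y | ρ / 2 < ‖y - u‖}.indicator (Q m' u) y := by
        intro y
        by_cases hy : y ∈ A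
        · have hy' : y ∈ {y | ρ / 2 < ‖y - u‖} := by
            rw [hA, Metric.mem_closedBall, dist_eq_norm] at hy
            show ρ / 2 < ‖y - u‖
            have : ‖u - z‖ ≤ ‖u - y‖ + ‖y - z‖ := norm_sub_le_norm_sub_add_norm_sub u y z
            rw [norm_sub_rev u y] at this
            linarith
          rw [Set.indicator_of_mem hy, Set.indicator_of_mem hy']
        · rw [Set.indicator_of_notMem hy]
          exact Set.indicator_nonneg (fun _ _ => hQnn _ _ _) _
      calc ∑' y, A.indicator (Q m' u) y ≤ ∑' y, {y | ρ / 2 < ‖y - u‖}.indicator (Q m' u) y :=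
            Summable.tsum_le_tsum hpt ((kpow_summable hP0 hPs hP1' hQ0 hQ m' u).indicator _)
              ((kpow_summable hP0 hPs hP1' hQ0 hQ m' u).indicator _)
        _ ≤ σ := hfarσ u m' hm'pos hm'
  have hmax := exit_mass_le_of_inner hP0 hP1 hQ0 hQ hRP0 hRP (A := A) z n hσ'
  -- 1 - (mass in A at time n) = mass outside A ≤ σ
  have hsn : Summable (Q n z) := kpow_summable hP0 hPs hP1' hQ0 hQ n z
  have hsplit : ∑' y, A.indicator (Q n z) y + ∑' y, Aᶜ.indicator (Q n z) y = 1 := by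
    rw [← Summable.tsum_add (hsn.indicator A) (hsn.indicator Aᶜ)]
    have : (fun y => A.indicator (Q n z) y + Aᶜ.indicator (Q n z) y) = Q n z := by
      funext y
      rw [← Pi.add_apply (A.indicator (Q n z)), Set.indicator_self_add_compl]
    rw [this]
    exact kpow_tsum_eq_one hP0 hP1 hQ0 hQ n z
  have hfar : ∑' y, Aᶜ.indicator (Q n z) y ≤ σ := by
    have hpt : ∀ y, Aᶜ.indicator (Q n z) y ≤ {y | ρ / 2 < ‖y - z‖}.indicator (Q n z) y := by
      intro y
      by_cases hy : y ∈ Aᶜ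
      · have hy' : y ∈ {y | ρ / 2 < ‖y - z‖} := by
          rw [Set.mem_compl_iff, hA, Metric.mem_closedBall, dist_eq_norm, not_le] at hy
          exact hy
        rw [Set.indicator_of_mem hy, Set.indicator_of_mem hy']
      · rw [Set.indicator_of_notMem hy]
        exact Set.indicator_nonneg (fun _ _ => hQnn _ _ _) _
    calc ∑' y, Aᶜ.indicator (Q n z) y ≤ ∑' y, {y | ρ / 2 < ‖y - z‖}.indicator (Q n z) y :=
          Summable.tsum_le_tsum hpt (hsn.indicator _) (hsn.indicator _)
      _ ≤ σ := hfarσ z n hn le_rfl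
  have hE1 := exit_mass_le_one hP0 hPs hP1' hRP0 hRP n z
  have hEnn := exit_mass_nonneg hP0 hRP0 hRP n z
  set E := ∑ j ∈ Finset.range n, ∑' u, ∑' w,
    RP j z w * (Metric.closedBall z ρ)ᶜ.indicator (P w) u with hE
  have h1 : E - σ * E ≤ σ := by
    have : (1 - σ) * E = E - σ * E := by ring
    linarith [hmax]
  have h2 : σ * E ≤ σ := mul_le_of_le_one_right hσnn hE1
  linarith

/-- **Iterated annulus crossing.** If from every point `z` the truncated chain (jumps `≤ ρ`)
leaves `B(z, ρ)` within `n` steps with probability at most `φ`, then it leaves `B(v, 2Iρ)` within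
`n` steps with probability at most `φ^I` (`I ≥ 1`): to cross the `I` annuli
`2iρ < ‖·−v‖ ≤ 2(i+1)ρ` it must, after each crossing, leave a ball of radius `ρ` around its
current position (`exit_mass_crossing`). This is the discrete, Poisson-type substitute for the
exponential exit bound of Bass–Levin Prop. 2.5. [cite: BassLevin2002, Prop. 2.5] -/
theorem trunc_exit_iter (hP0 : ∀ x y, 0 ≤ P x y) (hPs : ∀ x, Summable (P x))
    (hP1' : ∀ x, ∑' y, P x y ≤ 1) (hρ : 0 < ρ)
    (hK₁ : ∀ w z, K₁ w z = if ‖w - z‖ ≤ ρ then P w z else 0) {n : ℕ} {φ : ℝ} (hφ0 : 0 ≤ φ)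
    (hφ : ∀ (z : Fin d → ℤ) (Rz : ℕ → (Fin d → ℤ) → (Fin d → ℤ) → ℝ),
      (∀ x y, Rz 0 x y = if x = y then 1 else 0) →
      (∀ k x y, Rz (k + 1) x y = ∑' w, Rz k x w * (Metric.closedBall z ρ).indicator (K₁ w) y) →
      ∀ m' ≤ n, ∑ j ∈ Finset.range m', ∑' u, ∑' w,
        Rz j z w * (Metric.closedBall z ρ)ᶜ.indicator (K₁ w) u ≤ φ)
    (I : ℕ) (hI : 1 ≤ I) (v : Fin d → ℤ) (RB : ℕ → (Fin d → ℤ) → (Fin d → ℤ) → ℝ)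
    (hRB0 : ∀ x y, RB 0 x y = if x = y then 1 else 0)
    (hRB : ∀ k x y, RB (k + 1) x y =
      ∑' w, RB k x w * (Metric.closedBall v (2 * (I : ℝ) * ρ)).indicator (K₁ w) y) :
    ∑ j ∈ Finset.range n, ∑' u, ∑' w,
      RB j v w * (Metric.closedBall v (2 * (I : ℝ) * ρ))ᶜ.indicator (K₁ w) u ≤ φ ^ I := by
  have hK₁nn : ∀ w z, 0 ≤ K₁ w z := trunc_nonneg hP0 hK₁
  have hK₁s : ∀ w, Summable (K₁ w) := trunc_summable hP0 hPs hK₁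
  have hK₁1 : ∀ w, ∑' z, K₁ w z ≤ 1 := trunc_tsum_le_one hP0 hPs hP1' hK₁
  -- from any z' with B(z', ρ) ⊆ B, the exit mass from B within m' ≤ n steps is at most φ
  have hinner : ∀ (B : Set (Fin d → ℤ)) (R₂ : ℕ → (Fin d → ℤ) → (Fin d → ℤ) → ℝ),
      (∀ x y, R₂ 0 x y = if x = y then 1 else 0) →
      (∀ k x y, R₂ (k + 1) x y = ∑' w, R₂ k x w * B.indicator (K₁ w) y) →
      ∀ z', Metric.closedBall z' ρ ⊆ B → ∀ m' ≤ n,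
        ∑ j ∈ Finset.range m', ∑' u, ∑' w, R₂ j z' w * Bᶜ.indicator (K₁ w) u ≤ φ := by
    intro B R₂ hR₂0 hR₂ z' hz'B m' hm'
    obtain ⟨Rz, hRz0, hRz⟩ := exists_kpow (fun w y => (Metric.closedBall z' ρ).indicator (K₁ w) y)
    calc ∑ j ∈ Finset.range m', ∑' u, ∑' w, R₂ j z' w * Bᶜ.indicator (K₁ w) u
        ≤ ∑ j ∈ Finset.range m', ∑' u, ∑' w,
            Rz j z' w * (Metric.closedBall z' ρ)ᶜ.indicator (K₁ w) u :=
          exit_mass_antitone hK₁nn hK₁s hK₁1 hRz0 hRz hR₂0 hR₂ hz'B m' z'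
      _ ≤ φ := hφ z' Rz hRz0 hRz m' hm'
  induction I, hI using Nat.le_induction generalizing RB with
  | base =>
    have hsub : Metric.closedBall v ρ ⊆ Metric.closedBall v (2 * ((1 : ℕ) : ℝ) * ρ) :=
      Metric.closedBall_subset_closedBall (by push_cast; linarith)
    calc _ ≤ φ := hinner _ RB hRB0 hRB v hsub n le_rfl
      _ = φ ^ 1 := (pow_one φ).symm
  | succ I hI ih =>
    obtain ⟨R₁, hR₁0, hR₁⟩ :=
      exists_kpow (fun w y => (Metric.closedBall v (2 * (I : ℝ) * ρ)).indicator (K₁ w) y)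
    have hB₁ := ih R₁ hR₁0 hR₁
    have hI0 : (0 : ℝ) ≤ I := Nat.cast_nonneg I
    have h11' : Metric.closedBall v (2 * (I : ℝ) * ρ) ⊆
        Metric.closedBall v ((2 * (I : ℝ) + 1) * ρ) :=
      Metric.closedBall_subset_closedBall (by nlinarith)
    have h1'2 : Metric.closedBall v ((2 * (I : ℝ) + 1) * ρ) ⊆
        Metric.closedBall v (2 * ((I + 1 : ℕ) : ℝ) * ρ) :=
      Metric.closedBall_subset_closedBall (by push_cast; nlinarith)
    have hjump : ∀ w ∈ Metric.closedBall v (2 * (I : ℝ) * ρ), ∀ z,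
        z ∉ Metric.closedBall v ((2 * (I : ℝ) + 1) * ρ) → K₁ w z = 0 := by
      intro w hw z hz
      rw [Metric.mem_closedBall, dist_eq_norm] at hw
      rw [Metric.mem_closedBall, dist_eq_norm, not_le] at hz
      rw [hK₁, if_neg]
      intro hwz
      have : ‖z - v‖ ≤ ‖z - w‖ + ‖w - v‖ := norm_sub_le_norm_sub_add_norm_sub z w v
      rw [norm_sub_rev z w] at this
      linarith
    have hφb : ∀ z ∈ Metric.closedBall v ((2 * (I : ℝ) + 1) * ρ) \
        Metric.closedBall v (2 * (I : ℝ) * ρ), ∀ m' ≤ n,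
        ∑ j ∈ Finset.range m', ∑' u, ∑' w,
          RB j z w * (Metric.closedBall v (2 * ((I + 1 : ℕ) : ℝ) * ρ))ᶜ.indicator (K₁ w) u ≤ φ := by
      intro z hz m' hm'
      refine hinner _ RB hRB0 hRB z ?_ m' hm'
      intro w hw
      have hz1 := hz.1
      rw [Metric.mem_closedBall, dist_eq_norm] at hw hz1 ⊢
      have : ‖w - v‖ ≤ ‖w - z‖ + ‖z - v‖ := norm_sub_le_norm_sub_add_norm_sub w z v
      push_cast
      linarith
    have hv : v ∈ Metric.closedBall v (2 * (I : ℝ) * ρ) := Metric.mem_closedBall_self (by positivity)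
    calc _ ≤ φ * ∑ j ∈ Finset.range n, ∑' u, ∑' w,
          R₁ j v w * (Metric.closedBall v (2 * (I : ℝ) * ρ))ᶜ.indicator (K₁ w) u :=
          exit_mass_crossing hK₁nn hK₁s hK₁1 hR₁0 hR₁ hRB0 hRB h11' h1'2 hjump hφ0 hφb hv
      _ ≤ φ * φ ^ I := mul_le_mul_of_nonneg_left hB₁ hφ0
      _ = φ ^ (I + 1) := (pow_succ' φ I).symm

/-- Far mass of the truncated chain is bounded by its exit mass from the ball. [folklore] -/
theorem trunc_far_le_exit (hP0 : ∀ x y, 0 ≤ P x y) (hPs : ∀ x, Summable (P x))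
    (hP1' : ∀ x, ∑' y, P x y ≤ 1)
    (hK₁ : ∀ w z, K₁ w z = if ‖w - z‖ ≤ ρ then P w z else 0)
    (hR0 : ∀ x y, R 0 x y = if x = y then 1 else 0)
    (hR : ∀ n x y, R (n + 1) x y = ∑' z, R n x z * K₁ z y) {r : ℝ} (hr : 0 ≤ r)
    (v : Fin d → ℤ) {RB : ℕ → (Fin d → ℤ) → (Fin d → ℤ) → ℝ}
    (hRB0 : ∀ x y, RB 0 x y = if x = y then 1 else 0)
    (hRB : ∀ k x y, RB (k + 1) x y =
      ∑' w, RB k x w * (Metric.closedBall v r).indicator (K₁ w) y) (k : ℕ) :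
    ∑' z, {z | r < ‖z - v‖}.indicator (R k v) z ≤
      ∑ j ∈ Finset.range k, ∑' u, ∑' w, RB j v w * (Metric.closedBall v r)ᶜ.indicator (K₁ w) u := by
  have hK₁nn : ∀ w z, 0 ≤ K₁ w z := trunc_nonneg hP0 hK₁
  have hK₁s : ∀ w, Summable (K₁ w) := trunc_summable hP0 hPs hK₁
  have hK₁1 : ∀ w, ∑' z, K₁ w z ≤ 1 := trunc_tsum_le_one hP0 hPs hP1' hK₁
  have hAB : Disjoint {z : Fin d → ℤ | r < ‖z - v‖} (Metric.closedBall v r) := by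
    rw [Set.disjoint_left]
    intro z hz hz'
    rw [Metric.mem_closedBall, dist_eq_norm] at hz'
    exact absurd hz (not_lt.mpr hz')
  have hv : v ∈ Metric.closedBall v r := Metric.mem_closedBall_self hr
  exact tsum_indicator_kpow_le_exit_mass hK₁nn hK₁s hK₁1 hR0 hR hRB0 hRB hAB hv k

/-- **Midpoint splitting for the truncated chain.** If every point is at distance `> r` from `x`
or from `y`, then for `a, b ≥ 1`
`R (a+b) x y ≤ C_D b^{-d/α} · (mass of R a x · beyond r from x)
              + (M/m) C_D a^{-d/α} · (mass of R b y · beyond r from y)`,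
using `R ≤ Q ≤ C_D k^{-d/α}` and the reversibility of `R`. [folklore] -/
theorem trunc_kpow_le_far (hP0 : ∀ x y, 0 ≤ P x y) (hP1 : ∀ x, HasSum (P x) 1)
    (hμ : ∀ x, m ≤ μ x ∧ μ x ≤ M) (hm : 0 < m)
    (hrev : ∀ x y, μ x * P x y = μ y * P y x)
    (hK₁ : ∀ w z, K₁ w z = if ‖w - z‖ ≤ ρ then P w z else 0)
    (hQ0 : ∀ x y, Q 0 x y = if x = y then 1 else 0)
    (hQ : ∀ n x y, Q (n + 1) x y = ∑' z, Q n x z * P z y)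
    (hR0 : ∀ x y, R 0 x y = if x = y then 1 else 0)
    (hR : ∀ n x y, R (n + 1) x y = ∑' z, R n x z * K₁ z y)
    {C_D : ℝ} (hCD : 0 ≤ C_D)
    (hdiag : ∀ (n : ℕ) (x y : Fin d → ℤ), 1 ≤ n → Q n x y ≤ C_D * (n : ℝ) ^ (-(d : ℝ) / α))
    {r : ℝ} {x y : Fin d → ℤ} (hcover : ∀ z, r < ‖z - x‖ ∨ r < ‖z - y‖)
    {a b : ℕ} (ha : 1 ≤ a) (hb : 1 ≤ b) :
    R (a + b) x y ≤
      C_D * (b : ℝ) ^ (-(d : ℝ) / α) * ∑' z, {z | r < ‖z - x‖}.indicator (R a x) z +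
      M / m * (C_D * (a : ℝ) ^ (-(d : ℝ) / α)) * ∑' z, {z | r < ‖z - y‖}.indicator (R b y) z := by
  have hPs : ∀ x, Summable (P x) := fun x => (hP1 x).summable
  have hP1' : ∀ x, ∑' y, P x y ≤ 1 := fun x => ((hP1 x).tsum_eq).le
  have hμpos : ∀ x, 0 < μ x := fun x => lt_of_lt_of_le hm (hμ x).1
  have hM : 0 < M := lt_of_lt_of_le hm ((hμ y).1.trans (hμ y).2)
  have hK₁nn : ∀ w z, 0 ≤ K₁ w z := trunc_nonneg hP0 hK₁
  have hK₁s : ∀ w, Summable (K₁ w) := trunc_summable hP0 hPs hK₁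
  have hK₁1 : ∀ w, ∑' z, K₁ w z ≤ 1 := trunc_tsum_le_one hP0 hPs hP1' hK₁
  have hRnn : ∀ k x w, 0 ≤ R k x w := kpow_nonneg hK₁nn hR0 hR
  have hRQ : ∀ k w z, R k w z ≤ Q k w z :=
    kpow_mono_kernel hK₁nn (trunc_le hP0 hK₁) hPs hP1' hR0 hR hQ0 hQ
  have hRrev : ∀ k w z, μ w * R k w z = μ z * R k z w :=
    kpow_reversible hK₁nn hK₁s hK₁1 hR0 hR (trunc_reversible hrev hK₁)
  set Ca : ℝ := C_D * (a : ℝ) ^ (-(d : ℝ) / α) with hCa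
  set Cb : ℝ := C_D * (b : ℝ) ^ (-(d : ℝ) / α) with hCb
  have hCann : 0 ≤ Ca := mul_nonneg hCD (Real.rpow_nonneg (Nat.cast_nonneg a) _)
  have hCbnn : 0 ≤ Cb := mul_nonneg hCD (Real.rpow_nonneg (Nat.cast_nonneg b) _)
  have hRa : ∀ w z, R a w z ≤ Ca := fun w z => (hRQ a w z).trans (hdiag a w z ha)
  have hRb : ∀ w z, R b w z ≤ Cb := fun w z => (hRQ b w z).trans (hdiag b w z hb)
  -- pointwise bound of the Chapman–Kolmogorov integrand
  have hpt : ∀ z, R a x z * R b z y ≤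
      Cb * {z | r < ‖z - x‖}.indicator (R a x) z +
        M / m * Ca * {z | r < ‖z - y‖}.indicator (R b y) z := by
    intro z
    have h1nn : 0 ≤ Cb * {z | r < ‖z - x‖}.indicator (R a x) z :=
      mul_nonneg hCbnn (Set.indicator_nonneg (fun _ _ => hRnn a x _) _)
    have h2nn : 0 ≤ M / m * Ca * {z | r < ‖z - y‖}.indicator (R b y) z :=
      mul_nonneg (mul_nonneg (div_nonneg hM.le hm.le) hCann)
        (Set.indicator_nonneg (fun _ _ => hRnn b y _) _)
    rcases hcover z with hz | hz
    · have hz' : z ∈ {z | r < ‖z - x‖} := hz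
      have : {z | r < ‖z - x‖}.indicator (R a x) z = R a x z := Set.indicator_of_mem hz' _
      rw [this]
      calc R a x z * R b z y ≤ R a x z * Cb := mul_le_mul_of_nonneg_left (hRb z y) (hRnn a x z)
        _ = Cb * R a x z := mul_comm _ _
        _ ≤ Cb * R a x z + M / m * Ca * {z | r < ‖z - y‖}.indicator (R b y) z :=
            le_add_of_nonneg_right h2nn
    · have hz' : z ∈ {z | r < ‖z - y‖} := hz
      have : {z | r < ‖z - y‖}.indicator (R b y) z = R b y z := Set.indicator_of_mem hz' _
      rw [this]
      have hrel : R b z y ≤ M / m * R b y z := by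
        have hr' := hRrev b z y
        have : R b z y = (μ y / μ z) * R b y z := by
          rw [div_mul_eq_mul_div, eq_div_iff (hμpos z).ne']
          calc R b z y * μ z = μ z * R b z y := mul_comm _ _
            _ = μ y * R b y z := hr'
        rw [this]
        refine mul_le_mul_of_nonneg_right ?_ (hRnn b y z)
        exact div_le_div₀ hM.le (hμ y).2 hm (hμ z).1
      calc R a x z * R b z y ≤ Ca * (M / m * R b y z) :=
            mul_le_mul (hRa x z) hrel (hRnn b z y) hCann
        _ = M / m * Ca * R b y z := by ring
        _ ≤ Cb * {z | r < ‖z - x‖}.indicator (R a x) z + M / m * Ca * R b y z :=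
            le_add_of_nonneg_left h1nn
  have hs1 : Summable fun z => Cb * {z | r < ‖z - x‖}.indicator (R a x) z :=
    ((kpow_summable hK₁nn hK₁s hK₁1 hR0 hR a x).indicator _).mul_left _
  have hs2 : Summable fun z => M / m * Ca * {z | r < ‖z - y‖}.indicator (R b y) z :=
    ((kpow_summable hK₁nn hK₁s hK₁1 hR0 hR b y).indicator _).mul_left _
  rw [kpow_add hK₁nn hK₁s hK₁1 hR0 hR a b x y]
  calc ∑' z, R a x z * R b z y
      ≤ ∑' z, (Cb * {z | r < ‖z - x‖}.indicator (R a x) z +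
          M / m * Ca * {z | r < ‖z - y‖}.indicator (R b y) z) :=
        Summable.tsum_le_tsum hpt (summable_kpow_mul_kpow hK₁nn hK₁s hK₁1 hR0 hR a b x y)
          (hs1.add hs2)
    _ = Cb * ∑' z, {z | r < ‖z - x‖}.indicator (R a x) z +
          M / m * Ca * ∑' z, {z | r < ‖z - y‖}.indicator (R b y) z := by
        rw [Summable.tsum_add hs1 hs2, tsum_mul_left, tsum_mul_left]


/-- **Off-diagonal upper bound (Bass–Levin Thm 4.9, given on-diagonal bound and tightness).**
For a Markov kernel `P` on `ℤ^d` (`d ≥ 1`), reversible with respect to weights in `[m, M]`,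
with `P x y ≤ c₂ ‖x−y‖^{-(d+α)}`, the on-diagonal bound `Q n x y ≤ C_D n^{-d/α}` (`n ≥ 1`) and a
tightness bound with a rate, `∑_{‖z−x‖>r} Q k x z ≤ U k^{β/α} r^{-β}` (`k ≥ 1`, `r > 0`, some
`β > 0`): there is `C` with `Q n x y ≤ C n ‖x−y‖^{-(d+α)}` whenever `‖x − y‖ ≥ n^{1/α}`, `n ≥ 1`.
Proof: truncate the jumps at `ρ = ‖x−y‖/(5I)` with `I ≥ (d+α)/β`; long jumps contribute
`≤ n c₂ ρ^{-(d+α)} M/m` (`kpow_le_trunc_kpow_add`); the truncated chain contributes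
`≤ C n^{-d/α} φ^I` with `φ = 2U n^{β/α}(ρ/2)^{-β}` (`trunc_kpow_le_far`, `trunc_exit_iter`,
`exit_ball_le_of_tight`), and `n^{-d/α} (n^{1/α}/‖x−y‖)^{βI} ≤ n ‖x−y‖^{-(d+α)}`.
[cite: BassLevin2002, Thm 4.9] -/
theorem kpow_offdiag_bound (hd : 1 ≤ d) (hα : 0 < α) (hP0 : ∀ x y, 0 ≤ P x y)
    (hP1 : ∀ x, HasSum (P x) 1)
    (hμ : ∀ x, m ≤ μ x ∧ μ x ≤ M) (hm : 0 < m)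
    (hrev : ∀ x y, μ x * P x y = μ y * P y x)
    (hub : ∀ x y, P x y ≤ c₂ * ‖x - y‖ ^ (-((d : ℝ) + α))) (hc₂ : 0 ≤ c₂)
    (hQ0 : ∀ x y, Q 0 x y = if x = y then 1 else 0)
    (hQ : ∀ n x y, Q (n + 1) x y = ∑' z, Q n x z * P z y)
    {C_D : ℝ} (hCD : 0 ≤ C_D)
    (hdiag : ∀ (n : ℕ) (x y : Fin d → ℤ), 1 ≤ n → Q n x y ≤ C_D * (n : ℝ) ^ (-(d : ℝ) / α))
    {β U : ℝ} (hβ : 0 < β) (hU : 0 ≤ U)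
    (hT : ∀ (k : ℕ) (x : Fin d → ℤ) (r : ℝ), 1 ≤ k → 0 < r →
      ∑' z, {z | r < ‖z - x‖}.indicator (Q k x) z ≤ U * (k : ℝ) ^ (β / α) * r ^ (-β)) :
    ∃ C : ℝ, 0 < C ∧ ∀ (n : ℕ) (x y : Fin d → ℤ), 1 ≤ n → (n : ℝ) ^ (1 / α) ≤ ‖x - y‖ →
      Q n x y ≤ C * n * ‖x - y‖ ^ (-((d : ℝ) + α)) := by
  have _hd := hd
  have hPs : ∀ x, Summable (P x) := fun x => (hP1 x).summable
  have hP1' : ∀ x, ∑' y, P x y ≤ 1 := fun x => ((hP1 x).tsum_eq).le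
  have hM : 0 < M := lt_of_lt_of_le hm ((hμ 0).1.trans (hμ 0).2)
  have hMm : 0 ≤ M / m := div_nonneg hM.le hm.le
  set s : ℝ := (d : ℝ) + α with hs
  have hspos : 0 < s := by rw [hs]; positivity
  have hβα : 0 ≤ β / α := div_nonneg hβ.le hα.le
  -- number of annuli to cross
  obtain ⟨I, hIs⟩ : ∃ I : ℕ, s / β ≤ I := exists_nat_ge (s / β)
  have hI0 : (0 : ℝ) < I := lt_of_lt_of_le (div_pos hspos hβ) hIs
  have hI1 : 1 ≤ I := Nat.one_le_iff_ne_zero.mpr (by rintro rfl; simp at hI0)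
  have hβI : s ≤ β * I := by
    have := (div_le_iff₀ hβ).mp hIs
    linarith
  -- constants
  set Cφ : ℝ := 2 * U * (10 * (I : ℝ)) ^ β with hCφ
  have hCφnn : 0 ≤ Cφ := by positivity
  set C₁ : ℝ := C_D * (4 : ℝ) ^ ((d : ℝ) / α) * (1 + M / m) * Cφ ^ I with hC₁
  have hC₁nn : 0 ≤ C₁ := by positivity
  set C₂' : ℝ := c₂ * (5 * (I : ℝ)) ^ s * (M / m) with hC₂'
  have hC₂'nn : 0 ≤ C₂' := by positivity
  refine ⟨C₁ + C₂' + 1, by positivity, fun n x y hn hD => ?_⟩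
  set D : ℝ := ‖x - y‖ with hDdef
  have hn0 : (0 : ℝ) < n := by exact_mod_cast hn
  have hnD : 0 < (n : ℝ) ^ (1 / α) := Real.rpow_pos_of_pos hn0 _
  have hD0 : 0 < D := lt_of_lt_of_le hnD hD
  have h5I : (0 : ℝ) < 5 * I := by positivity
  set ρ : ℝ := D / (5 * I) with hρdef
  have hρ : 0 < ρ := div_pos hD0 h5I
  set K₁ : (Fin d → ℤ) → (Fin d → ℤ) → ℝ := fun w z => if ‖w - z‖ ≤ ρ then P w z else 0
    with hK₁def
  set K₂ : (Fin d → ℤ) → (Fin d → ℤ) → ℝ := fun w z => if ‖w - z‖ ≤ ρ then 0 else P w z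
    with hK₂def
  have hK₁ : ∀ w z, K₁ w z = if ‖w - z‖ ≤ ρ then P w z else 0 := fun w z => rfl
  have hK₂ : ∀ w z, K₂ w z = if ‖w - z‖ ≤ ρ then 0 else P w z := fun w z => rfl
  obtain ⟨R, hR0, hR⟩ := exists_kpow K₁
  have hK₁nn : ∀ w z, 0 ≤ K₁ w z := trunc_nonneg hP0 hK₁
  have hK₁s : ∀ w, Summable (K₁ w) := trunc_summable hP0 hPs hK₁
  have hK₁1 : ∀ w, ∑' z, K₁ w z ≤ 1 := trunc_tsum_le_one hP0 hPs hP1' hK₁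
  have hRnn : ∀ k x w, 0 ≤ R k x w := kpow_nonneg hK₁nn hR0 hR
  -- Step 1: Meyer decomposition
  have h1 : Q n x y ≤ R n x y + n * (c₂ * ρ ^ (-s)) * (M / m) :=
    kpow_le_trunc_kpow_add hP0 hP1 hμ hm hrev hub hc₂ hspos.le hρ hK₁ hK₂ hQ0 hQ hR0 hR n x y
  have hρs : ρ ^ (-s) = (5 * (I : ℝ)) ^ s * D ^ (-s) := by
    rw [hρdef, Real.div_rpow hD0.le h5I.le, Real.rpow_neg h5I.le, div_inv_eq_mul, mul_comm]
  -- Step 2: the truncated chain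
  have h2 : R n x y ≤ C₁ * n * D ^ (-s) := by
    have hDs : 0 < D ^ (-s) := Real.rpow_pos_of_pos hD0 _
    rcases Nat.lt_or_ge n 2 with hn2 | hn2
    · -- n = 1 : one truncated step cannot reach y
      have hn1 : n = 1 := by omega
      subst hn1
      have hR1 : R 1 x y = 0 := by
        rw [kpow_one hR0 hR, hK₁, if_neg]
        rw [not_le, hρdef, div_lt_iff₀ h5I]
        have : (1 : ℝ) ≤ I := by exact_mod_cast hI1
        nlinarith
      rw [hR1]; positivity
    · set a : ℕ := n / 2 with ha
      set b : ℕ := n - n / 2 with hb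
      have hab : a + b = n := by omega
      have ha1 : 1 ≤ a := by omega
      have hb1 : 1 ≤ b := by omega
      have ha4 : n ≤ 4 * a := by omega
      have hb4 : n ≤ 4 * b := by omega
      -- the escape radius
      set r : ℝ := 2 * (I : ℝ) * ρ with hr
      have hr0 : 0 ≤ r := by positivity
      have hrD : 2 * r < D := by
        have : r = 2 * D / 5 := by rw [hr, hρdef]; field_simp
        rw [this]; linarith
      have hcover : ∀ z, r < ‖z - x‖ ∨ r < ‖z - y‖ := by
        intro z
        by_contra h
        push Not at h
        have : ‖x - y‖ ≤ ‖x - z‖ + ‖z - y‖ := norm_sub_le_norm_sub_add_norm_sub x z y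
        rw [norm_sub_rev x z] at this
        linarith [h.1, h.2]
      -- one crossing
      set φ : ℝ := 2 * (U * (n : ℝ) ^ (β / α) * (ρ / 2) ^ (-β)) with hφ
      have hφ0 : 0 ≤ φ := by positivity
      have hφhyp : ∀ (z : Fin d → ℤ) (Rz : ℕ → (Fin d → ℤ) → (Fin d → ℤ) → ℝ),
          (∀ x y, Rz 0 x y = if x = y then 1 else 0) →
          (∀ k x y, Rz (k + 1) x y =
            ∑' w, Rz k x w * (Metric.closedBall z ρ).indicator (K₁ w) y) →
          ∀ m' ≤ n, ∑ j ∈ Finset.range m', ∑' u, ∑' w,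
            Rz j z w * (Metric.closedBall z ρ)ᶜ.indicator (K₁ w) u ≤ φ := by
        intro z Rz hRz0 hRz m' hm'
        obtain ⟨RP, hRP0, hRP⟩ :=
          exists_kpow (fun w y => (Metric.closedBall z ρ).indicator (P w) y)
        calc _ ≤ ∑ j ∈ Finset.range n, ∑' u, ∑' w,
              Rz j z w * (Metric.closedBall z ρ)ᶜ.indicator (K₁ w) u :=
              exit_mass_mono hK₁nn hRz0 hRz hm' z
          _ ≤ ∑ j ∈ Finset.range n, ∑' u, ∑' w,
              RP j z w * (Metric.closedBall z ρ)ᶜ.indicator (P w) u :=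
              exit_mass_mono_kernel hK₁nn (trunc_le hP0 hK₁) hPs hP1' hRz0 hRz hRP0 hRP n z
          _ ≤ φ := exit_ball_le_of_tight hP0 hP1 hQ0 hQ hβα hU hT hρ z hRP0 hRP n hn
      -- escape beyond r: at most φ^I
      have hesc : ∀ (v : Fin d → ℤ) (k : ℕ), k ≤ n →
          ∑' z, {z | r < ‖z - v‖}.indicator (R k v) z ≤ φ ^ I := by
        intro v k hk
        obtain ⟨RB, hRB0, hRB⟩ :=
          exists_kpow (fun w y => (Metric.closedBall v r).indicator (K₁ w) y)
        calc _ ≤ ∑ j ∈ Finset.range k, ∑' u, ∑' w,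
              RB j v w * (Metric.closedBall v r)ᶜ.indicator (K₁ w) u :=
              trunc_far_le_exit hP0 hPs hP1' hK₁ hR0 hR hr0 v hRB0 hRB k
          _ ≤ ∑ j ∈ Finset.range n, ∑' u, ∑' w,
              RB j v w * (Metric.closedBall v r)ᶜ.indicator (K₁ w) u :=
              exit_mass_mono hK₁nn hRB0 hRB hk v
          _ ≤ φ ^ I := trunc_exit_iter hP0 hPs hP1' hρ hK₁ hφ0 hφhyp I hI1 v RB hRB0 hRB
      -- midpoint splitting
      have hmid := trunc_kpow_le_far hP0 hP1 hμ hm hrev hK₁ hQ0 hQ hR0 hR hCD hdiag hcover ha1 hb1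
      rw [hab] at hmid
      have hka : ∀ k : ℕ, 1 ≤ k → n ≤ 4 * k →
          (k : ℝ) ^ (-(d : ℝ) / α) ≤ (4 : ℝ) ^ ((d : ℝ) / α) * (n : ℝ) ^ (-(d : ℝ) / α) := by
        intro k hk h4
        have hk0 : (0 : ℝ) < k := by exact_mod_cast hk
        have hle : (n : ℝ) / 4 ≤ k := by
          rw [div_le_iff₀ (by norm_num : (0 : ℝ) < 4)]
          exact_mod_cast (by omega : n ≤ k * 4)
        have hexp : -(d : ℝ) / α ≤ 0 := by
          rw [neg_div]; exact neg_nonpos.mpr (div_nonneg (Nat.cast_nonneg d) hα.le)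
        calc (k : ℝ) ^ (-(d : ℝ) / α) ≤ ((n : ℝ) / 4) ^ (-(d : ℝ) / α) :=
              Real.rpow_le_rpow_of_nonpos (by positivity) hle hexp
          _ = (4 : ℝ) ^ ((d : ℝ) / α) * (n : ℝ) ^ (-(d : ℝ) / α) := by
              rw [Real.div_rpow hn0.le (by norm_num), neg_div,
                Real.rpow_neg (by norm_num : (0 : ℝ) ≤ 4), div_inv_eq_mul, mul_comm]
      -- φ^I in terms of n and D
      have hφI : (n : ℝ) ^ (-(d : ℝ) / α) * φ ^ I ≤ Cφ ^ I * (n * D ^ (-s)) := by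
        set t : ℝ := (n : ℝ) ^ (1 / α) / D with ht
        have ht0 : 0 < t := div_pos hnD hD0
        have ht1 : t ≤ 1 := (div_le_one hD0).mpr hD
        have hφt : φ = Cφ * t ^ β := by
          have h1 : (n : ℝ) ^ (β / α) = ((n : ℝ) ^ (1 / α)) ^ β := by
            rw [← Real.rpow_mul hn0.le, one_div_mul_eq_div]
          have h2 : (ρ / 2) ^ (-β) = (10 * (I : ℝ)) ^ β * D ^ (-β) := by
            have h10I : (0 : ℝ) < 10 * I := by positivity
            have : ρ / 2 = D / (10 * I) := by
              rw [hρdef, div_div]; congr 1; ring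
            rw [this, Real.div_rpow hD0.le h10I.le, Real.rpow_neg h10I.le, div_inv_eq_mul,
              mul_comm]
          have h3 : t ^ β = ((n : ℝ) ^ (1 / α)) ^ β * D ^ (-β) := by
            rw [ht, Real.div_rpow hnD.le hD0.le, Real.rpow_neg hD0.le, div_eq_mul_inv]
          rw [hφ, hCφ, h1, h2, h3]; ring
        have htI : (t ^ β) ^ I = t ^ (β * I) := by
          rw [← Real.rpow_natCast, ← Real.rpow_mul ht0.le]
        have hts : t ^ (β * I) ≤ t ^ s := Real.rpow_le_rpow_of_exponent_ge ht0 ht1 hβI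
        have ht_s : t ^ s = (n : ℝ) ^ (s / α) * D ^ (-s) := by
          rw [ht, Real.div_rpow hnD.le hD0.le, ← Real.rpow_mul hn0.le, one_div_mul_eq_div,
            Real.rpow_neg hD0.le, div_eq_mul_inv]
        have hnn : (n : ℝ) ^ (-(d : ℝ) / α) * (n : ℝ) ^ (s / α) = n := by
          rw [← Real.rpow_add hn0]
          have : -(d : ℝ) / α + s / α = 1 := by
            rw [hs]; field_simp; ring
          rw [this, Real.rpow_one]
        calc (n : ℝ) ^ (-(d : ℝ) / α) * φ ^ I
            = (n : ℝ) ^ (-(d : ℝ) / α) * (Cφ ^ I * t ^ (β * I)) := by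
              rw [hφt, mul_pow, htI]
          _ ≤ (n : ℝ) ^ (-(d : ℝ) / α) * (Cφ ^ I * t ^ s) := by
              refine mul_le_mul_of_nonneg_left (mul_le_mul_of_nonneg_left hts (by positivity)) ?_
              exact Real.rpow_nonneg hn0.le _
          _ = Cφ ^ I * (((n : ℝ) ^ (-(d : ℝ) / α) * (n : ℝ) ^ (s / α)) * D ^ (-s)) := by
              rw [ht_s]; ring
          _ = Cφ ^ I * (n * D ^ (-s)) := by rw [hnn]
      have hFX := hesc x a (by omega)
      have hFY := hesc y b (by omega)
      have hFXnn : 0 ≤ ∑' z, {z | r < ‖z - x‖}.indicator (R a x) z :=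
        tsum_nonneg fun z => Set.indicator_nonneg (fun _ _ => hRnn a x _) _
      have hFYnn : 0 ≤ ∑' z, {z | r < ‖z - y‖}.indicator (R b y) z :=
        tsum_nonneg fun z => Set.indicator_nonneg (fun _ _ => hRnn b y _) _
      have hnq : 0 ≤ (n : ℝ) ^ (-(d : ℝ) / α) := Real.rpow_nonneg hn0.le _
      have h4q : 0 ≤ (4 : ℝ) ^ ((d : ℝ) / α) * (n : ℝ) ^ (-(d : ℝ) / α) := by positivity
      calc R n x y
          ≤ C_D * (b : ℝ) ^ (-(d : ℝ) / α) * ∑' z, {z | r < ‖z - x‖}.indicator (R a x) z +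
            M / m * (C_D * (a : ℝ) ^ (-(d : ℝ) / α)) *
              ∑' z, {z | r < ‖z - y‖}.indicator (R b y) z := hmid
        _ ≤ C_D * ((4 : ℝ) ^ ((d : ℝ) / α) * (n : ℝ) ^ (-(d : ℝ) / α)) * φ ^ I +
            M / m * (C_D * ((4 : ℝ) ^ ((d : ℝ) / α) * (n : ℝ) ^ (-(d : ℝ) / α))) * φ ^ I := by
            refine add_le_add ?_ ?_
            · exact mul_le_mul (mul_le_mul_of_nonneg_left (hka b hb1 hb4) hCD) hFX hFXnn
                (mul_nonneg hCD h4q)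
            · exact mul_le_mul (mul_le_mul_of_nonneg_left
                (mul_le_mul_of_nonneg_left (hka a ha1 ha4) hCD) hMm) hFY hFYnn
                (mul_nonneg hMm (mul_nonneg hCD h4q))
        _ = C_D * (4 : ℝ) ^ ((d : ℝ) / α) * (1 + M / m) * ((n : ℝ) ^ (-(d : ℝ) / α) * φ ^ I) := by
            ring
        _ ≤ C_D * (4 : ℝ) ^ ((d : ℝ) / α) * (1 + M / m) * (Cφ ^ I * (n * D ^ (-s))) :=
            mul_le_mul_of_nonneg_left hφI (by positivity)
        _ = C₁ * n * D ^ (-s) := by rw [hC₁]; ring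
  -- Step 3: combine
  have hDs : 0 < D ^ (-s) := Real.rpow_pos_of_pos hD0 _
  calc Q n x y ≤ R n x y + n * (c₂ * ρ ^ (-s)) * (M / m) := h1
    _ ≤ C₁ * n * D ^ (-s) + C₂' * n * D ^ (-s) := by
        rw [hρs]
        refine add_le_add h2 (le_of_eq ?_)
        rw [hC₂']; ring
    _ ≤ (C₁ + C₂' + 1) * n * D ^ (-s) := by nlinarith [mul_pos hn0 hDs]

end Trunc

end Literature.Probability.Process
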